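import Summits.BirchSwinnertonDyer.BirchSwinnertonDyer.Theorems.ThetaPartnerAtTwoSignedKatoUpToAtTwoInvolChain
import Literature.NumberTheory.EllipticCurves.Kato2004.EulerSystemBoundFineSelmerContragredient
import Literature.NumberTheory.EllipticCurves.IwasawaAlgebraDivisibilityProofs
import Literature.NumberTheory.EllipticCurves.Kim2025.FineOneSidedDivisibility
import HarnessLib

/-!
# K8 crux 20445 `PlusKatoDivisibilityBranchOnto`: the CHAIN^ι — Kobayashi's four-term road with an ι-SEMILINEAR
# Poitou–Tate map, the PRINT-EXACT Kato 13.4 (Q73′) and a functional equation give the Kato divisibility at EVERY prime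

Cell `bsd-potss` (HOME `run/shared/lean/pub/bsd-potss/`), seat `bsd-potss-k8q-c2x` g9 (prover; lane B of the K8 Kato
side), duty T-Q73ι-1, companion of `…PlusKatoDivisibilityBranchOntoOfNamedFactsContra` (parts 1–2). HONEST FRAMING:
THEOREMS ONLY — no definition, no named fact, no instance, no `sorry`; route-independent of K8 (no `Theses` import of
`QuadraticBranchSignedControl`); closes no item; Kato's theorem (Q73′ =
`Kato2004.thm13_4_lengthAt_fineSelmerDualContra_le_of_isEulerSystemClass`) is a displayed hypothesis where used; the
Poitou–Tate package and the functional equation are RAW HYPOTHESES on maps and elements (no structure of the tree is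
asserted to satisfy them); BSD is not proved by any of this; nothing is booked.

## Why this file

Part 1 shows that with `hZ` AS TYPED (`Kobayashi2003.thm62_63_73_etaColemanPoitouTate_zeta`: the (7.21) map
`j : Λ →ₗ[Λ] X(D)` is `Λ`-LINEAR, `D`, `FB` over `γ`) the literal re-keying of 20445 to Q73′ costs an unprinted
`ι`-symmetry. The bsd-wall cell's convention audit for the `p = 2` twin (`Cruxes/SignedKatoDivisibilityUpToAtTwo/
G4-CONVENTION-AUDIT.md` §1) resolved the same mismatch the other way: in the tree's conventions (Kato's `𝐇¹` covariant,
the Pontryagin duals by PRE-composition with `conj_γ`) the Poitou–Tate map into the dual is `ι`-SEMILINEAR, and then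
Kato-contra + the FUNCTIONAL EQUATION of the `p`-adic `L`-function close the chain at every prime (their registered
stub `stub_involChainTwo`, landed). THIS FILE is the K8 / odd-`p` kernel form of that chain, so that a print-exact
re-reading of Kobayashi's (7.21) at `η` (a typer's call, NOT made here) has its glue ready:

* §1 `lengthAt_le_of_semilinearFourTerm_of_katoInv_of_fe` (pure algebra over `Λ = ℤ_p⟦T⟧`): for `col : H ↪ Λ`
  linear, `j : Λ → X` ADDITIVE and `ι`-semilinear with `j ∘ col = 0`, `k : X → Y` linear with `ker k ⊆ im j`, `z ∈ H`
  with `col z ≠ 0`, at a height-one `𝔭`: the Kato inequality read at `ι𝔭` (`ℓ_𝔭(Y) ≤ ℓ_{ι𝔭}(H/Λz)`) and the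
  functional-equation identity `ℓ_{ι𝔭}(Λ/(col z)) = ℓ_𝔭(Λ/(col z))` give `ℓ_𝔭(X) ≤ ℓ_𝔭(Λ/(col z))`
  (`SignedKatoOffTwo.fourTerm_lengthAt_le_upTo_semilinear` with `σ = ι`, exponents `0`).
* §2 `lengthAt_le_of_fe`: the functional equation `ι L = v·L`, `v ∈ Λˣ`, as the length identity at every prime
  (bsd-wall `lengthAt_quotient_span_comap_invol_eq_of_fe`, re-spelt for `IwasawaAlgebra.invol`).
* §3 `katoDivisibility_of_semilinearPT_of_thm13_4Contra_of_fe`: for an elliptic `W/ℚ`, odd `p`, the pinned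
  `I : IwasawaH1Data W p κ γ`, the tree fine dual `FB : W.FineSelmerDualData κ γ`, a genuine Euler-system class `z` under
  Kato's (v), an injective linear `col : 𝐇¹ → Λ`, ANY `Λ`-module `X` receiving an `ι`-semilinear `j : Λ → X` with
  `j ∘ col = 0` and a linear `k : X → X₀` with `ker k ⊆ im j`, and a functional equation for `L := col z`: from Q73′,
  `ℓ_𝔭(X) ≤ ℓ_𝔭(Λ/(L))` at every height-one `𝔭 ∌ p` (clause (2)), at every height-one `𝔭` under clause (3)'s hypotheses;
  hence (`…_charIdeal`) `p^m·L ∈ char_Λ X` for some `m`, and `L ∈ char_Λ X` under clause (3), for `X` finitely generated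
  torsion. With `X = X⁺(V/K_∞)^η`, `col = Col⁺ ∘ loc`, `L = L_p⁺(V,η,X)` this is the Kato half of Kobayashi Thm. 4.1
  at `η` at EVERY prime — what 20445 consumes — over `{print-exact (7.21), Q73′, FE_η}`.

What is NOT claimed: that the tree's `hZ` supplies such a semilinear `j` (it supplies a LINEAR one); that the functional
equation of `L_p⁺(V, η, X)` on the quadratic branch is in the tree (it is print: Mazur–Tate–Teitelbaum §I.17 with
`η⁻¹ = η`, and Pollack's half-logarithms are `ι`-symmetric up to units; the tree has the `p = 2` / trivial-branch
forms only); any item closure.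

References: [Kobayashi2003] (7.17)–(7.21), Thm. 7.3, proof of Thm. 7.4 (pp. 12–13); [Kato2004Asterisque] Thm. 13.4 (2)(3)
(p. 226), §17.13 (p. 280); [MazurTateTeitelbaum1986Invent] §I.17; [Pollack2003] Thm. 5.13; [GreenbergLNM1716] §1 p. 60
and pp. 67–68; [Washington1997] §13.2.
-/

noncomputable section

-- justification: the `Summit.BirchSwinnertonDyer.BirchSwinnertonDyer.…` path repeats a component (route-file convention)
set_option linter.dupNamespace false
set_option autoImplicit false

open scoped Classical

open Field PowerSeries
open Literature.NumberTheory.EllipticCurves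
open Literature.NumberTheory.EllipticCurves.Module
open Literature.NumberTheory.GaloisRepresentations
open Literature.Barriers.BirchSwinnertonDyer

namespace Summit.BirchSwinnertonDyer.BirchSwinnertonDyer.Theorems

namespace KatoSideInvolChain

open SignedKatoOffTwo SignedKatoOffTwo.IwasawaInvolution

/-! ## §1 The four-term road with an `ι`-semilinear Poitou–Tate map, at one height-one prime -/

section Algebra

variable {p : ℕ} [Fact p.Prime] {H X Y : Type*} [AddCommGroup H] [_root_.Module (IwasawaAlgebra p) H]
  [AddCommGroup X] [_root_.Module (IwasawaAlgebra p) X] [AddCommGroup Y] [_root_.Module (IwasawaAlgebra p) Y]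

/-- **CHAIN^ι at one prime (pure algebra).** `col : H ↪ Λ` linear, `j : Λ → X` additive and `ι`-semilinear with
`j ∘ col = 0`, `k : X → Y` linear with `ker k ⊆ im j`, `z ∈ H` with `col z ≠ 0`, `H` finitely generated. At a
height-one prime `𝔭`, the Kato inequality READ AT `ι𝔭` — `ℓ_𝔭(Y) ≤ ℓ_{ι𝔭}(H/Λz)` — and the functional-equation
identity `ℓ_{ι𝔭}(Λ/(col z)) = ℓ_𝔭(Λ/(col z))` give `ℓ_𝔭(X) ≤ ℓ_𝔭(Λ/(col z))`. Proof:
`ℓ_𝔭(X) + ℓ_{ι𝔭}(H/Λz) ≤ ℓ_𝔭(Y) + ℓ_{ι𝔭}(Λ/(col z))` (semilinear four-term road, exponents `0`), cancel the finite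
`ℓ_{ι𝔭}(H/Λz)` (`col z` kills `H/Λz`). [cite: Kobayashi2003, proof of Thm. 7.4 (p. 13)] [cite: Kato2004Asterisque, §17.13 (p. 280)] -/
theorem lengthAt_le_of_semilinearFourTerm_of_katoInv_of_fe [Module.Finite (IwasawaAlgebra p) H]
    (col : H →ₗ[IwasawaAlgebra p] IwasawaAlgebra p) (hcol : Function.Injective col)
    (j : IwasawaAlgebra p →+ X) (hj : ∀ (g y : IwasawaAlgebra p), j (g • y) = IwasawaAlgebra.invol p g • j y)
    (k : X →ₗ[IwasawaAlgebra p] Y) (hcj : ∀ x : H, j (col x) = 0) (hjk : ∀ x : X, k x = 0 → ∃ y, j y = x)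
    (z : H) (hz : col z ≠ 0) (𝔭 : PrimeSpectrum (IwasawaAlgebra p)) (h𝔭 : 𝔭.asIdeal.height = 1)
    (hK : lengthAt (IwasawaAlgebra p) Y 𝔭 ≤
      lengthAt (IwasawaAlgebra p) (H ⧸ Submodule.span (IwasawaAlgebra p) {z})
        (PrimeSpectrum.comap (IwasawaAlgebra.invol p).toRingHom 𝔭))
    (hFE : lengthAt (IwasawaAlgebra p) (IwasawaAlgebra p ⧸ Ideal.span {col z})
        (PrimeSpectrum.comap (IwasawaAlgebra.invol p).toRingHom 𝔭) =
      lengthAt (IwasawaAlgebra p) (IwasawaAlgebra p ⧸ Ideal.span {col z}) 𝔭) :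
    lengthAt (IwasawaAlgebra p) X 𝔭 ≤ lengthAt (IwasawaAlgebra p) (IwasawaAlgebra p ⧸ Ideal.span {col z}) 𝔭 := by
  let ιe : IwasawaAlgebra p ≃+* IwasawaAlgebra p :=
    (IwasawaAlgebra.involEquiv p : IwasawaAlgebra p ≃+* IwasawaAlgebra p)
  set 𝔮 : PrimeSpectrum (IwasawaAlgebra p) := PrimeSpectrum.comap (IwasawaAlgebra.invol p).toRingHom 𝔭 with h𝔮def
  have h𝔮𝔭 : 𝔮.asIdeal = 𝔭.asIdeal.comap ιe := ideal_comap_invol_toRingHom p 𝔭.asIdeal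
  have h𝔮 : 𝔮.asIdeal.height = 1 := by rw [h𝔮def, height_comap_invol, h𝔭]
  have hu : (1 : IwasawaAlgebra p) ∉ 𝔮.asIdeal := fun h ↦ 𝔮.isPrime.ne_top ((Ideal.eq_top_iff_one _).mpr h)
  have hu' : (1 : IwasawaAlgebra p) ∉ 𝔭.asIdeal := fun h ↦ 𝔭.isPrime.ne_top ((Ideal.eq_top_iff_one _).mpr h)
  have h4 := fourTerm_lengthAt_le_upTo_semilinear ιe h𝔮𝔭 (LinearMap.id : IwasawaAlgebra p →ₗ[IwasawaAlgebra p] _)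
    col j (fun g y ↦ hj g y) k hu hu' (fun y hy ↦ by rw [one_smul]; exact hy)
    (fun x hx ↦ by rw [one_smul]; exact hcol (hx.trans (map_zero col).symm))
    (fun x ↦ by rw [one_smul]; exact hcj x) (fun x hx ↦ by rw [one_smul]; exact hjk x hx) z
  -- `ℓ_𝔮(H/Λz)` is finite: `col z ≠ 0` kills `H/Λz`
  have htb : Module.IsTorsionBy (IwasawaAlgebra p) (H ⧸ Submodule.span (IwasawaAlgebra p) {z}) (col z) := by
    intro x
    induction x using Submodule.Quotient.induction_on with
    | H m =>
      rw [← Submodule.Quotient.mk_smul, Submodule.Quotient.mk_eq_zero, Submodule.mem_span_singleton]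
      refine ⟨col m, hcol ?_⟩
      rw [map_smul, map_smul, smul_eq_mul, smul_eq_mul, mul_comm]
  have hfin : lengthAt (IwasawaAlgebra p) (H ⧸ Submodule.span (IwasawaAlgebra p) {z}) 𝔮 ≠ ⊤ :=
    Module.lengthAt_ne_top_of_isTorsionBy hz htb 𝔮 (le_of_eq h𝔮)
  have h : lengthAt (IwasawaAlgebra p) X 𝔭 +
        lengthAt (IwasawaAlgebra p) (H ⧸ Submodule.span (IwasawaAlgebra p) {z}) 𝔮 ≤
      lengthAt (IwasawaAlgebra p) (IwasawaAlgebra p ⧸ Ideal.span {col z}) 𝔭 +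
        lengthAt (IwasawaAlgebra p) (H ⧸ Submodule.span (IwasawaAlgebra p) {z}) 𝔮 :=
    h4.trans ((add_le_add hK (le_of_eq hFE)).trans (le_of_eq (add_comm _ _)))
  exact (WithTop.add_le_add_iff_right hfin).mp h

/-! ## §2 The functional equation as a length identity at every prime -/

/-- **`ι L = v·L` with `v ∈ Λˣ` ⟹ `ℓ_{ι𝔭}(Λ/(L)) = ℓ_𝔭(Λ/(L))` at every prime `𝔭`** (bsd-wall
`lengthAt_quotient_span_comap_invol_eq_of_fe`, with the named involution `IwasawaAlgebra.invol p`).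
[cite: GreenbergLNM1716, §1 pp. 67–68] [cite: MazurTateTeitelbaum1986Invent, §I.17] -/
theorem lengthAt_quotient_span_comap_invol_eq_of_invol_eq {L v : IwasawaAlgebra p} (hv : IsUnit v)
    (hFE : IwasawaAlgebra.invol p L = v * L) (𝔭 : PrimeSpectrum (IwasawaAlgebra p)) :
    lengthAt (IwasawaAlgebra p) (IwasawaAlgebra p ⧸ Ideal.span {L})
        (PrimeSpectrum.comap (IwasawaAlgebra.invol p).toRingHom 𝔭) =
      lengthAt (IwasawaAlgebra p) (IwasawaAlgebra p ⧸ Ideal.span {L}) 𝔭 := by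
  rw [Invol.invol_eq_subst_invOnePlusSubOne] at hFE
  exact lengthAt_quotient_span_comap_invol_eq_of_fe hv hFE 𝔭

end Algebra

/-! ## §3 The K8 form: semilinear Poitou–Tate data + Q73′ + functional equation ⟹ Kato divisibility at every prime -/

section KEight

variable {p : ℕ} [Fact p.Prime] {W : WeierstrassCurve ℚ} [W.IsElliptic]
  [ContinuousSMul ℤ_[p] (W.tateModule p)] [Module.Free ℤ_[p] (W.tateModule p)]
  [Module.Finite ℤ_[p] (W.tateModule p)] {κ : ZpExtension ℚ p} {γ : absoluteGaloisGroup ℚ}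
  {X : Type*} [AddCommGroup X] [_root_.Module (IwasawaAlgebra p) X]

/-- **CHAIN^ι for K8, length form.** For an elliptic `W/ℚ`, odd `p`, cyclotomic `κ` with generator `γ`, the pinned
`I : IwasawaH1Data W p κ γ` and the TREE fine dual `FB : W.FineSelmerDualData κ γ`, a genuine Euler-system class
`z ∈ 𝐇¹_Γ(T_pW)` under Kato's (v), an injective `Λ`-linear `col : 𝐇¹ → Λ` («`Col⁺ ∘ loc`»), ANY `Λ`-module `X`
(«`X⁺(V/K_∞)^η`») with an ADDITIVE `ι`-SEMILINEAR `j : Λ → X`, `j ∘ col = 0`, a `Λ`-linear `k : X → X₀` with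
`ker k ⊆ im j` (the print-exact shape of Kobayashi's (7.21) in the tree's conventions), and a functional equation
`ι(col z) = v·(col z)`, `v ∈ Λˣ`: from Q73′, `ℓ_𝔭(X) ≤ ℓ_𝔭(Λ/(col z))` at every height-one `𝔭 ∌ p`, and at every
height-one `𝔭` if `W[p]` is irreducible with a free rank-one `Coker(ρ σ − 1)`. Proof: Q73′ on the `γ⁻¹`-twist of
`FB` at `ι𝔭` = the Kato inequality read at `ι𝔭`; §1; §2.
[cite: Kato2004Asterisque, Thm. 13.4 (2)(3) (p. 226)] [cite: Kobayashi2003, Thm. 7.3 and proof of Thm. 7.4 (p. 13)] -/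
theorem lengthAt_le_of_semilinearPT_of_thm13_4Contra_of_fe
    (h134c : Kato2004.thm13_4_lengthAt_fineSelmerDualContra_le_of_isEulerSystemClass)
    (hp2 : p ≠ 2) (hκ : κ.IsCyclotomic) (hγ : κ.IsTopGenerator γ) (I : Kato2004.IwasawaH1Data W p κ γ)
    (FB : W.FineSelmerDualData κ γ) (z : I.H) (hz : Kato2004.IsEulerSystemClass W p κ γ I z)
    (hv : ∃ σ : absoluteGaloisGroup ℚ,
      (∀ (n : ℕ) (t : AlgebraicClosure ℚ), t ^ p ^ n = 1 → σ • t = t) ∧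
        Module.finrank ℤ_[p] ((W.tateModule p) ⧸ LinearMap.range (W.galoisRepTate p σ - 1)) = 1)
    (col : I.H →ₗ[IwasawaAlgebra p] IwasawaAlgebra p) (hcol : Function.Injective col) (hz0 : col z ≠ 0)
    (j : IwasawaAlgebra p →+ X) (hj : ∀ (g y : IwasawaAlgebra p), j (g • y) = IwasawaAlgebra.invol p g • j y)
    (k : X →ₗ[IwasawaAlgebra p] FB.X) (hcj : ∀ x : I.H, j (col x) = 0) (hjk : ∀ x : X, k x = 0 → ∃ y, j y = x)
    {v : IwasawaAlgebra p} (hvu : IsUnit v) (hFE : IwasawaAlgebra.invol p (col z) = v * col z) :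
    (∀ 𝔭 : PrimeSpectrum (IwasawaAlgebra p), 𝔭.asIdeal.height = 1 →
      PowerSeries.C (p : ℤ_[p]) ∉ 𝔭.asIdeal →
        lengthAt (IwasawaAlgebra p) X 𝔭 ≤
          lengthAt (IwasawaAlgebra p) (IwasawaAlgebra p ⧸ Ideal.span {col z}) 𝔭) ∧
    (W.HasIrreducibleModPGaloisRep p →
      (∃ σ : absoluteGaloisGroup ℚ,
        (∀ (n : ℕ) (t : AlgebraicClosure ℚ), t ^ p ^ n = 1 → σ • t = t) ∧
          Nonempty (((W.tateModule p) ⧸ LinearMap.range (W.galoisRepTate p σ - 1)) ≃ₗ[ℤ_[p]] ℤ_[p])) →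
      ∀ 𝔭 : PrimeSpectrum (IwasawaAlgebra p), 𝔭.asIdeal.height = 1 →
        lengthAt (IwasawaAlgebra p) X 𝔭 ≤
          lengthAt (IwasawaAlgebra p) (IwasawaAlgebra p ⧸ Ideal.span {col z}) 𝔭) := by
  haveI : Module.Finite (IwasawaAlgebra p) I.H := Kato2004.IwasawaH1Data.module_finite_of_isCyclotomic hκ hγ I
  have hz' : z ≠ 0 := fun h ↦ hz0 (by rw [h, map_zero])
  -- Q73′ on the `γ⁻¹`-twist `FB'` of the tree dual: the Kato inequality read at `ι𝔭`
  obtain ⟨FB', e, -, -, -, -, hlen⟩ := exists_twist_fineSelmerDualData_invol (p := p) (mul_inv_cancel γ) FB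
  obtain ⟨h2, h3⟩ := h134c W p κ γ hp2 hκ hγ I FB' z hz hz' hv
  have hK : ∀ 𝔭 : PrimeSpectrum (IwasawaAlgebra p), 𝔭.asIdeal.height = 1 →
      (PowerSeries.C (p : ℤ_[p]) ∉ 𝔭.asIdeal ∨
        (W.HasIrreducibleModPGaloisRep p ∧ ∃ σ : absoluteGaloisGroup ℚ,
          (∀ (n : ℕ) (t : AlgebraicClosure ℚ), t ^ p ^ n = 1 → σ • t = t) ∧
            Nonempty (((W.tateModule p) ⧸ LinearMap.range (W.galoisRepTate p σ - 1)) ≃ₗ[ℤ_[p]] ℤ_[p]))) →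
      lengthAt (IwasawaAlgebra p) FB.X 𝔭 ≤
        lengthAt (IwasawaAlgebra p) (I.H ⧸ Submodule.span (IwasawaAlgebra p) {z})
          (PrimeSpectrum.comap (IwasawaAlgebra.invol p).toRingHom 𝔭) := by
    intro 𝔭 h𝔭 hcase
    set 𝔓 := PrimeSpectrum.comap (IwasawaAlgebra.invol p).toRingHom 𝔭 with h𝔓
    have h𝔭𝔓 : PrimeSpectrum.comap (IwasawaAlgebra.invol p).toRingHom 𝔓 = 𝔭 := comap_invol_comap_invol p 𝔭
    have h𝔓ht : 𝔓.asIdeal.height = 1 := by rw [h𝔓, height_comap_invol, h𝔭]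
    calc lengthAt (IwasawaAlgebra p) FB.X 𝔭
        = lengthAt (IwasawaAlgebra p) FB.X (PrimeSpectrum.comap (IwasawaAlgebra.invol p).toRingHom 𝔓) := by
          rw [h𝔭𝔓]
      _ = lengthAt (IwasawaAlgebra p) FB'.X 𝔓 := hlen 𝔓
      _ ≤ lengthAt (IwasawaAlgebra p) (I.H ⧸ Submodule.span (IwasawaAlgebra p) {z}) 𝔓 := by
          rcases hcase with hp𝔭 | ⟨hirr, h3W⟩
          · exact h2 𝔓 h𝔓ht (by rw [h𝔓, C_mem_comap_invol_iff]; exact hp𝔭)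
          · exact h3 hirr h3W 𝔓 h𝔓ht
  have hFE' := lengthAt_quotient_span_comap_invol_eq_of_invol_eq hvu hFE
  exact ⟨fun 𝔭 h𝔭 hp𝔭 ↦ lengthAt_le_of_semilinearFourTerm_of_katoInv_of_fe col hcol j hj k hcj hjk z hz0 𝔭 h𝔭
      (hK 𝔭 h𝔭 (Or.inl hp𝔭)) (hFE' 𝔭),
    fun hirr h3W 𝔭 h𝔭 ↦ lengthAt_le_of_semilinearFourTerm_of_katoInv_of_fe col hcol j hj k hcj hjk z hz0 𝔭 h𝔭
      (hK 𝔭 h𝔭 (Or.inr ⟨hirr, h3W⟩)) (hFE' 𝔭)⟩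

/-- **CHAIN^ι for K8, characteristic-ideal form** (the shape 20445 consumes): under the hypotheses of
`lengthAt_le_of_semilinearPT_of_thm13_4Contra_of_fe` and for `X` finitely generated `Λ`-torsion,
`p^m · col z ∈ char_Λ X` for some `m` (clause (2) + Washington §13.2), and `col z ∈ char_Λ X` if `W[p]` is irreducible
with a free rank-one `Coker(ρ σ − 1)` (clause (3)). With `col z = L_p⁺(V, η, X)·unit` this is
«`(L_p⁺) ⊆ Char X⁺(V/K_∞)^η`» up to a power of `p`, resp. integrally. CONDITIONAL on Q73′ (displayed) and on the raw
package hypotheses; closes nothing. [cite: Kobayashi2003, Thm. 4.1 (p. 8) and proof of Thm. 7.4 (p. 13)]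
[cite: Kato2004Asterisque, Thm. 13.4 (2)(3) (p. 226)] [cite: Washington1997, §13.2] -/
theorem katoDivisibility_of_semilinearPT_of_thm13_4Contra_of_fe [Module.Finite (IwasawaAlgebra p) X]
    (hX : Module.IsTorsion (IwasawaAlgebra p) X)
    (h134c : Kato2004.thm13_4_lengthAt_fineSelmerDualContra_le_of_isEulerSystemClass)
    (hp2 : p ≠ 2) (hκ : κ.IsCyclotomic) (hγ : κ.IsTopGenerator γ) (I : Kato2004.IwasawaH1Data W p κ γ)
    (FB : W.FineSelmerDualData κ γ) (z : I.H) (hz : Kato2004.IsEulerSystemClass W p κ γ I z)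
    (hv : ∃ σ : absoluteGaloisGroup ℚ,
      (∀ (n : ℕ) (t : AlgebraicClosure ℚ), t ^ p ^ n = 1 → σ • t = t) ∧
        Module.finrank ℤ_[p] ((W.tateModule p) ⧸ LinearMap.range (W.galoisRepTate p σ - 1)) = 1)
    (col : I.H →ₗ[IwasawaAlgebra p] IwasawaAlgebra p) (hcol : Function.Injective col) (hz0 : col z ≠ 0)
    (j : IwasawaAlgebra p →+ X) (hj : ∀ (g y : IwasawaAlgebra p), j (g • y) = IwasawaAlgebra.invol p g • j y)
    (k : X →ₗ[IwasawaAlgebra p] FB.X) (hcj : ∀ x : I.H, j (col x) = 0) (hjk : ∀ x : X, k x = 0 → ∃ y, j y = x)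
    {v : IwasawaAlgebra p} (hvu : IsUnit v) (hFE : IwasawaAlgebra.invol p (col z) = v * col z) :
    (∃ m : ℕ, (PowerSeries.C (p : ℤ_[p]) : IwasawaAlgebra p) ^ m * col z ∈ charIdeal (IwasawaAlgebra p) X) ∧
    (W.HasIrreducibleModPGaloisRep p →
      (∃ σ : absoluteGaloisGroup ℚ,
        (∀ (n : ℕ) (t : AlgebraicClosure ℚ), t ^ p ^ n = 1 → σ • t = t) ∧
          Nonempty (((W.tateModule p) ⧸ LinearMap.range (W.galoisRepTate p σ - 1)) ≃ₗ[ℤ_[p]] ℤ_[p])) →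
      col z ∈ charIdeal (IwasawaAlgebra p) X) := by
  obtain ⟨h2, h3⟩ := lengthAt_le_of_semilinearPT_of_thm13_4Contra_of_fe h134c hp2 hκ hγ I FB z hz hv col hcol
    hz0 j hj k hcj hjk hvu hFE
  refine ⟨Module.exists_pow_mul_mem_charIdeal_of_lengthAt_le hX (IwasawaAlgebra.prime_C p) hz0 h2,
    fun hirr h3W ↦ ?_⟩
  have hQ : Module.IsTorsion (IwasawaAlgebra p) (IwasawaAlgebra p ⧸ Ideal.span {col z}) := by
    have hby : Module.IsTorsionBy (IwasawaAlgebra p) (IwasawaAlgebra p ⧸ Ideal.span {col z}) (col z) :=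
      (Module.isTorsionBy_quotient_iff _ _).mpr fun y ↦ by
        rw [smul_eq_mul]
        exact Ideal.mul_mem_right y _ (Ideal.mem_span_singleton_self _)
    exact fun x ↦ ⟨⟨col z, mem_nonZeroDivisors_of_ne_zero hz0⟩, @hby x⟩
  have hle : charIdeal (IwasawaAlgebra p) (IwasawaAlgebra p ⧸ Ideal.span {col z}) ≤
      charIdeal (IwasawaAlgebra p) X :=
    Kim2025.charIdeal_le_charIdeal_of_lengthAt_le hQ hX (h3 hirr h3W)
  rw [charIdeal_eq_span_of_lengthAt_eq_quotient hz0 fun _ _ ↦ rfl, Ideal.span_singleton_le_iff_mem] at hle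
  exact hle

end KEight

end KatoSideInvolChain

end Summit.BirchSwinnertonDyer.BirchSwinnertonDyer.Theorems

end
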